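import Literature.IUT.LogThetaLattice.ThetaLinkOfKits
import Literature.IUT.LogThetaLattice.FrobeniusChainCoricOfKits
import Mathlib.CategoryTheory.InducedCategory
import HarnessLib

/-!
# [IUTchIII] Def 1.4 / Prop 1.2 (x) INHABITED at `StripFrame.ofKits` FOR EVERY KIT DATUM, by tagging the `ℱ`-side

Mochizuki, *Inter-universal Teichmüller Theory III*, kurims manuscript (May 2020), Def 1.1 p. 23, Prop 1.2 (x) p. 34 ("a collection of
distinct `F`-prime-strips … indexed by the integers"), Def 1.4 p. 45 ("a collection of distinct `Θ^{±ell}NF`-Hodge theaters … indexed by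
pairs of integers"), Thm 1.5 (i)(ii) p. 48, Def 3.8 (iii) p. 113; *I* (May 2020) Def 5.2 (i)–(iv) pp. 134–135, Rmk 5.2.1 p. 143, Cor 5.3 (ii)(iii)
p. 144, Def 6.11 (iii) p. 173; *II* (Dec 2020) Def 4.9 (vi)–(viii) p. 158, Cor 4.10 (i)–(iv) pp. 158–160. abc-iut cell, seat abc-iut-w5-d043
(L6 NV row «NV-W2 IUTchIII:Def1.4», part W2c = the GENERIC form of `LatticeDiagramOfKitsTaggedToy.lean` / `ChainsOfKitsTaggedToy.lean`).

abc-iut-L6-t3's `LogThetaLatticeDiagram.ofKits L hbij hsurj hR X TK LK kind (H : ℤ × ℤ → FK.ThetaPMEllHT) (hH : Function.Injective H)`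
asks for an INJECTIVE family of Hodge-theater structures and abc-iut-w5-d197/w5-d005's criterion for Prop 1.2 (x)'s Frobenius-picture
chain at `StripFrame.ofKits` is `Infinite FK.FStrip`; neither can be met over a kit whose ambient categories `FAmb v` hold only finitely
many provably distinct isomorphs of the models (abc-iut-L5-t4's toy kit). THIS FILE shows that BOTH are met over EVERY kit datum after
TAGGING the `ℱ`-side — the kernel rendering of print's "distinct copies indexed by (pairs of) integers" — and that every structure of the
`StripFrame.ofKits` signature TRANSFERS along the tagging by one-liners (tags are invisible to the rigidity statements):

* § 1 **`FK.tagF ι i₀`**: `FAmb v := InducedCategory (FK.FAmb v) Prod.snd` on `ι × FK.FAmb v` (Mathlib; each object duplicated `ι` times,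
  copies canonically isomorphic, `inducedFunctor` fully faithful), models tagged `i₀`, `ℱ ↦ 𝒟` / `ℱ ↦ ℱ^⊢` / `ℱ ↦ ℱ^⊩` through the
  forgetful functor, `ℱ̲ ↦ ℱ` through `tagLift i₀`; everything else verbatim. Transfers: `MonoLaws.tagF`, `isomFtoDBijective_tagF`
  ([IUTchI] Cor 5.3 (ii): composed with the bijection `FStrip.untagFIsoEquiv` on isomorphism collections), `isomFmtoDmSurjective_tagF`,
  `rlfOfIsStrip_tagF`, `TimesMuSide.tagF` ([IUTchII] Def 4.9: same categories, functors precomposed with forgetting the tag),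
  `HTRep.untagF` (a functor of abc-iut-L6-t3's representative-level Hodge-theater groupoids), `ThetaLinkKit.tagF` (Cor 4.10 (i)–(iv) pilots
  through `untagF`), `LogKit.tagF` (Def 1.1 (i): `log` acts on the second coordinate).
* § 2 the families: `FStrip.tagF q F` (the tag-`q` copy of an `ℱ`-prime-strip), `ThetaPMEllHT.tagF H₀ p` (the theater `H₀` with its codomain
  strip `†𝔉_≻` re-tagged `p`), injective as soon as the kit has a place `v₀` (`thetaPMEllHT_tagF_injective`, `infinite_fStrip_tagF`).
* § 3 **for EVERY kit datum `(FK, L, hbij, hsurj, hR, X, TK, LK)`, every theater `H₀ : FK.ThetaPMEllHT`, every place `v₀` and `ι := ℤ × ℤ`**: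
  `latticeDiagramTagF … kind : LogThetaLatticeDiagram (LogStripData.ofKits …) (ThetaLinkData.ofKits …)` ([IUTchIII] Def 1.4 INHABITED at
  the tagged kit frame, with Thm 1.5 (i)(ii) for it and abc-iut-L6-t4's Def 3.8 (iii) skeleton `lgpSkeletonTagF`), and
  `nonempty_frobeniusChain_ofKits_tagF` (Prop 1.2 (x) INHABITED there, any infinite `ι`).
So the clauses «distinct» / `Function.Injective` / `Infinite FK.FStrip` constrain NO kit datum: they are met by relabelling. HONEST LABEL
(abc-iut-L6-lead §F v1.19j (1)): tagged copies of ONE theater; bookkeeping about the typed kit signature plus a non-vacuity consequence, NOT a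
construction of genuine Hodge theaters; nothing here bears on the real-kit line (abc-iut-L5-t4). No Prop fact, no instance. Consistency ≠
endorsement; typed ≠ proved; no side taken on [IUTchIII] Cor 3.12. [claim: Mochizuki2012, status: disputed]
-/

noncomputable section

/-! ### 1. Tagging the `ℱ`-side of a kit, and the transfers -/

namespace Literature.IUT.HodgeTheaters.PMBaseKit

open CategoryTheory

universe u

variable {l : ℕ} {K : PMBaseKit.{u} l} {M : K.MultKit}

namespace FKit

variable (FK : K.FKit M) (ι : Type u) (i₀ : ι)

/-- **IUTchI:Def5.2(i)** (kurims p.134) Tagging an object with `i₀`, functorially: `X ↦ (i₀, X)` into the induced category on `ι × C`.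
[folklore] -/
def tagLift {C : Type u} [Category.{u} C] (i₀ : ι) : C ⥤ InducedCategory C (Prod.snd : ι × C → C) where
  obj X := (i₀, X)
  map f := InducedCategory.homMk f

/-- **IUTchI:Def5.2(i)** (kurims p.134) **The `ℱ`-tagged kit**: `FK` with every ambient category of "collections of data of the type
of `ℱ_v`" replaced by its `ι`-fold tagged copy `InducedCategory (FK.FAmb v) Prod.snd`; models tagged `i₀`; the algorithms `ℱ ↦ 𝒟`,
`ℱ ↦ ℱ^⊢`, `ℱ ↦ ℱ^⊩` (Rmk 5.2.1) read through the (fully faithful) forgetful functor, `ℱ̲ ↦ ℱ` through `tagLift i₀`; the `ℱ^⊢`-, `ℱ^⊩`-,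
`ℱ̲`- and `𝒟^⊢`-sides verbatim. [claim: Mochizuki2012, status: disputed] -/
def tagF : K.FKit M where
  FAmb v := InducedCategory (FK.FAmb v) (Prod.snd : ι × FK.FAmb v → FK.FAmb v)
  fModel v := (i₀, FK.fModel v)
  FmAmb := FK.FmAmb
  fmModel := FK.fmModel
  toD v := inducedFunctor _ ⋙ FK.toD v
  toD_model v := FK.toD_model v
  toFm v := inducedFunctor _ ⋙ FK.toFm v
  toFm_model v := FK.toFm_model v
  RlfAmb := FK.RlfAmb
  rlfModel := FK.rlfModel
  rlfFm := FK.rlfFm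
  rlfOf F := FK.rlfOf fun v => (inducedFunctor _).obj (F v)
  rlfOfMap φ := FK.rlfOfMap fun v => (inducedFunctor _).mapIso (φ v)
  rlfFm_rlfOf F v := FK.rlfFm_rlfOf (fun v => (inducedFunctor _).obj (F v)) v
  ThAmb := FK.ThAmb
  thModel := FK.thModel
  thToF v := FK.thToF v ⋙ tagLift ι i₀
  thToF_model v := InducedCategory.isoMk (FK.thToF_model v)
  toDm := FK.toDm
  toDmMap φ := FK.toDmMap φ
  toDm_toFm F hF := FK.toDm_toFm (fun v => (inducedFunctor _).obj (F v)) fun v => ⟨(inducedFunctor _).mapIso (hF v).some⟩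

variable {FK}

/-- **IUTchI:Def5.2(i)** (kurims p.134) Forgetting the tags of an `ℱ`-prime-strip of the tagged kit. [claim: Mochizuki2012, status: disputed] -/
def FStrip.untagF (F : (FK.tagF ι i₀).FStrip) : FK.FStrip :=
  ⟨fun v => (inducedFunctor _).obj (F.obj v), fun v => ⟨(inducedFunctor _).mapIso (F.isModel v).some⟩⟩

/-- **IUTchI:Def5.2(i)** (kurims p.134) The copy with tag `q` (at every place) of an `ℱ`-prime-strip of `FK`. [claim: Mochizuki2012, status: disputed] -/
def FStrip.tagF (q : ι) (F : FK.FStrip) : (FK.tagF ι i₀).FStrip :=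
  ⟨fun v => (q, F.obj v), fun v => ⟨InducedCategory.isoMk (F.isModel v).some⟩⟩

/-- **IUTchI:Def5.2(iii)** (kurims p.134) A morphism of tagged `ℱ`-prime-strips IS a morphism of the underlying ones ("a collection of
isomorphisms, indexed by `𝕍`" — the tag carries no morphism data): the bijection. [claim: Mochizuki2012, status: disputed] -/
def FStrip.untagFIsoEquiv (F₁ F₂ : (FK.tagF ι i₀).FStrip) :
    F₁.Iso F₂ ≃ (FStrip.untagF ι i₀ F₁).Iso (FStrip.untagF ι i₀ F₂) where
  toFun φ := fun v => (inducedFunctor _).mapIso (φ v)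
  invFun ψ := fun v => InducedCategory.isoMk (ψ v)
  left_inv _ := rfl
  right_inv _ := rfl

/-- **IUTchI:Def5.2(ii)** (kurims p.134) An `ℱ^⊢`-prime-strip of the tagged kit read as one of `FK` (same constituents).
[claim: Mochizuki2012, status: disputed] -/
abbrev FmStrip.untagF (F : (FK.tagF ι i₀).FmStrip) : FK.FmStrip := ⟨F.obj, F.isModel⟩

/-- **IUTchI:Def5.2(iv)** (kurims p.134) An `ℱ^⊩`-prime-strip of the tagged kit read as one of `FK` (same collection of data).
[claim: Mochizuki2012, status: disputed] -/
abbrev FrStrip.untagF (F : (FK.tagF ι i₀).FrStrip) : FK.FrStrip := ⟨F.obj, F.isModel⟩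

/-- **IUTchI:Rmk5.2.1(i)** (kurims p.143) abc-iut-L5-d4's `MonoLaws` transfer to the `ℱ`-tagged kit (the chosen compatibility
isomorphism and its naturality are those of `FK` at the untagged strips). [claim: Mochizuki2012, status: disputed] -/
def MonoLaws.tagF (L : FK.MonoLaws) : (FK.tagF ι i₀).MonoLaws where
  toDmMap_refl F := L.toDmMap_refl F
  toDmMap_trans φ ψ := L.toDmMap_trans φ ψ
  monoMap_refl D := L.monoMap_refl D
  monoMap_trans φ ψ := L.monoMap_trans φ ψ
  toDmToFm F := L.toDmToFm (FStrip.untagF ι i₀ F)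
  toDmToFm_natural {F₁ F₂} φ :=
    L.toDmToFm_natural (F₁ := FStrip.untagF ι i₀ F₁) (F₂ := FStrip.untagF ι i₀ F₂) (FStrip.untagFIsoEquiv ι i₀ F₁ F₂ φ)

/-- **IUTchI:Cor5.3(ii)** (kurims p.144) Cor 5.3 (ii) transfers to the `ℱ`-tagged kit: `Isom(¹𝔉, ²𝔉) → Isom(¹𝔇, ²𝔇)` for tagged strips is
the untagged map composed with the bijection `untagFIsoEquiv`. [claim: Mochizuki2012, status: disputed] -/
theorem isomFtoDBijective_tagF (h : FK.IsomFtoDBijective) : (FK.tagF ι i₀).IsomFtoDBijective :=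
  fun F₁ F₂ => (h (FStrip.untagF ι i₀ F₁) (FStrip.untagF ι i₀ F₂)).comp (FStrip.untagFIsoEquiv ι i₀ F₁ F₂).bijective

/-- **IUTchI:Cor5.3(iii)** (kurims p.144) Cor 5.3 (iii) transfers VERBATIM (the `ℱ^⊢`-side is untouched). [claim: Mochizuki2012, status: disputed] -/
theorem isomFmtoDmSurjective_tagF (h : FK.IsomFmtoDmSurjective) : (FK.tagF ι i₀).IsomFmtoDmSurjective :=
  fun F₁ F₂ => h (FmStrip.untagF ι i₀ F₁) (FmStrip.untagF ι i₀ F₂)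

/-- **IUTchI:Rmk5.2.1(ii)** (kurims p.143) Rmk 5.2.1 (ii) transfers VERBATIM (`‡𝔉 ↦ ‡𝔉^⊩` forgets the tag first). [claim: Mochizuki2012, status: disputed] -/
theorem rlfOfIsStrip_tagF (h : FK.RlfOfIsStrip) : (FK.tagF ι i₀).RlfOfIsStrip :=
  fun F => h (FStrip.untagF ι i₀ F)

/-- **IUTchI:Def5.2(ii)** (kurims p.134) Forgetting the (absent) tag on `ℱ^⊢`-prime-strips, functorially. [claim: Mochizuki2012, status: disputed] -/
def fmStripUntagF : (FK.tagF ι i₀).FmStrip ⥤ FK.FmStrip where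
  obj F := FmStrip.untagF ι i₀ F
  map φ := φ
  map_id _ := rfl
  map_comp _ _ := rfl

/-- **IUTchI:Def5.2(iv)** (kurims p.135) Forgetting the (absent) tag on `ℱ^⊩`-prime-strips, functorially. [claim: Mochizuki2012, status: disputed] -/
def frStripUntagF : (FK.tagF ι i₀).FrStrip ⥤ FK.FrStrip where
  obj F := FrStrip.untagF ι i₀ F
  map φ := φ
  map_id _ := rfl
  map_comp _ _ := rfl

/-! #### The representative-level Hodge-theater groupoid: forgetting the tags -/

/-- **IUTchI:Def6.11(iii)** (kurims p.173) A `Θ^{±ell}`-Hodge theater over the tagged kit read over `FK`: forget the tags of the capsule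
and codomain `ℱ`-prime-strips (the associated `𝒟-Θ^{±ell}`-Hodge theater is literally unchanged). [claim: Mochizuki2012, status: disputed] -/
def ThetaPMEllHT.untagF (H : (FK.tagF ι i₀).ThetaPMEllHT) : FK.ThetaPMEllHT where
  T := H.T
  fintypeT := H.fintypeT
  grpT := H.grpT
  capsule t := FStrip.untagF ι i₀ (H.capsule t)
  codomain := FStrip.untagF ι i₀ H.codomain
  glob := H.glob
  dPolyPM := H.dPolyPM
  dPolyEll := H.dPolyEll
  exists_model := H.exists_model

/-- **IUTchI:Def6.11(iii)** (kurims p.173) The theater `H₀` over `FK` with its capsule strips tagged `i₀` and its codomain strip `†𝔉_≻`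
tagged `p` — "the same Hodge theater, regarded as the copy labelled `p`". [claim: Mochizuki2012, status: disputed] -/
def ThetaPMEllHT.tagF (H₀ : FK.ThetaPMEllHT) (p : ι) : (FK.tagF ι i₀).ThetaPMEllHT where
  T := H₀.T
  fintypeT := H₀.fintypeT
  grpT := H₀.grpT
  capsule t := FStrip.tagF ι i₀ i₀ (H₀.capsule t)
  codomain := FStrip.tagF ι i₀ p H₀.codomain
  glob := H₀.glob
  dPolyPM := H₀.dPolyPM
  dPolyEll := H₀.dPolyEll
  exists_model := H₀.exists_model

end FKit

end Literature.IUT.HodgeTheaters.PMBaseKit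

namespace Literature.IUT.LogThetaLattice

open CategoryTheory
open Literature.IUT.HodgeArakelov Literature.IUT.HodgeTheaters Literature.IUT.HodgeTheaters.PMBaseKit

universe u

section Generic

variable {l : ℕ} {K : PMBaseKit.{u} l} {M : K.MultKit} {FK : K.FKit M} {L : FK.MonoLaws} (ι : Type u) (i₀ : ι)

/-- **IUTchI:Def6.11(iii)** (kurims p.173) **Forgetting the tags, functorially on representatives**: a representative of an isomorphism of
tagged theaters (abc-iut-L6-t3's `FRepIso`: a `𝒟`-level representative with single lifts of its capsule / codomain constituents) gives
one of the untagged theaters — same `𝒟`-level representative, lifts read through the forgetful functor. [claim: Mochizuki2012, status: disputed] -/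
def HTRep.untagF : HTRep (FK.tagF ι i₀) ⥤ HTRep FK where
  obj X := HTRep.of (FKit.ThetaPMEllHT.untagF ι i₀ X.out)
  map f :=
    { toD := f.toD
      caps := fun t v => (inducedFunctor _).mapIso (f.caps t v)
      cod := fun v => (inducedFunctor _).mapIso (f.cod v)
      caps_lifts := fun t => f.caps_lifts t
      cod_lifts := f.cod_lifts }
  map_id _ := rfl
  map_comp _ _ := rfl

/-- **IUTchII:Def4.9(vii)** (kurims p.158) The [IUTchII] Def 4.9 input `TimesMuSide` transfers to the `ℱ`-tagged kit: the SAME categories of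
`F^{⊢×μ}`-, `F^{⊢▶×μ}`-, `F^{⊩▶×μ}`-prime-strips, functors precomposed with forgetting the tag. [claim: Mochizuki2012, status: disputed] -/
def TimesMuSide.tagF (X : TimesMuSide FK L) : TimesMuSide (FK.tagF ι i₀) (L.tagF ι i₀) where
  Fxm := X.Fxm
  Fvtxm := X.Fvtxm
  Fglxm := X.Fglxm
  FvToFxm := FKit.fmStripUntagF ι i₀ ⋙ X.FvToFxm
  FxmToDv := X.FxmToDv
  FglToFglxm := FKit.frStripUntagF ι i₀ ⋙ X.FglToFglxm
  FglxmToFvtxm := X.FglxmToFvtxm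
  FvtxmToFxm := X.FvtxmToFxm
  fxm_comm := Functor.isoWhiskerLeft (FKit.fmStripUntagF ι i₀) X.fxm_comm
  iso_nonempty_Fxm := X.iso_nonempty_Fxm
  iso_nonempty_Fglxm := X.iso_nonempty_Fglxm

variable {ι i₀}

/-- **IUTchII:Cor4.10(i)** (kurims p.158) The Cor 4.10 (i)–(iv) kit datum `ThetaLinkKit` transfers to the `ℱ`-tagged kit: pilot-strip functors
through `HTRep.untagF`, unit portions whiskered, "coincides with the full poly-isomorphism" read at the untagged theaters.
[claim: Mochizuki2012, status: disputed] -/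
def ThetaLinkKit.tagF {X : TimesMuSide FK L} (TK : ThetaLinkKit X) : ThetaLinkKit (X.tagF ι i₀) where
  pilotDelta := HTRep.untagF ι i₀ ⋙ TK.pilotDelta
  pilotTheta k := HTRep.untagF ι i₀ ⋙ TK.pilotTheta k
  unitPortion k := Functor.isoWhiskerLeft (HTRep.untagF ι i₀) (TK.unitPortion k)
  induced_full k H H' := TK.induced_full k ((HTRep.untagF ι i₀).obj H) ((HTRep.untagF ι i₀).obj H')

variable (ι i₀)

/-- **IUTchIII:Def1.1(i)** (kurims p.24) The Def 1.1 (i) kit datum `LogKit` transfers to the `ℱ`-tagged kit: `log` acts on the second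
coordinate, its model clause and Rmk 1.1.2 (i) base-identification read through the forgetful functor. [claim: Mochizuki2012, status: disputed] -/
def LogKit.tagF (LK : LogKit FK) : LogKit (FK.tagF ι i₀) where
  log v :=
    { obj := fun Y => (Y.1, (LK.log v).obj (Prod.snd Y))
      map := fun f => InducedCategory.homMk ((LK.log v).map f.hom)
      map_id := fun Y => InducedCategory.hom_ext ((LK.log v).map_id (Prod.snd Y))
      map_comp := fun f g => InducedCategory.hom_ext ((LK.log v).map_comp f.hom g.hom) }
  log_model v := ⟨InducedCategory.isoMk (LK.log_model v).some⟩
  logD v := NatIso.ofComponents (fun Y => (LK.logD v).app (Prod.snd Y)) (fun f => (LK.logD v).hom.naturality f.hom)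

/-! ### 2. The injective families -/

/-- **IUTchI:Def5.2(i)** (kurims p.134) The tag of a tagged copy is read off at any place `v₀`. [claim: Mochizuki2012, status: disputed] -/
theorem fStrip_tagF_obj (q : ι) (F : FK.FStrip) (v₀ : K.V) :
    ((FKit.FStrip.tagF ι i₀ q F).obj v₀ : ι × FK.FAmb v₀).1 = q := rfl

/-- **IUTchI:Def5.2(i)** (kurims p.134) At a kit with a place, distinct tags give DISTINCT copies of an `ℱ`-prime-strip.
[claim: Mochizuki2012, status: disputed] -/
theorem fStrip_tagF_injective (v₀ : K.V) (F : FK.FStrip) :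
    Function.Injective fun q : ι => FKit.FStrip.tagF ι i₀ q F := by
  intro p q h
  exact congrArg (fun G : (FK.tagF ι i₀).FStrip => (G.obj v₀ : ι × FK.FAmb v₀).1) h

/-- **IUTchI:Def5.2(i)** (kurims p.134) Hence, for `ι` infinite and a kit with a place, the tagged kit has INFINITELY MANY `ℱ`-prime-strips
(in print the isomorphs of `ℱ_v` form a proper class). [claim: Mochizuki2012, status: disputed] -/
theorem infinite_fStrip_tagF [Infinite ι] (v₀ : K.V) : Infinite (FK.tagF ι i₀).FStrip :=
  Infinite.of_injective _ (fStrip_tagF_injective ι i₀ v₀ ⟨FK.fModel, fun _ => ⟨Iso.refl _⟩⟩)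

/-- **IUTchIII:Def1.4** (kurims p.45) **"Distinct"**: for every theater `H₀` of a kit with a place `v₀`, the family `p ↦ H₀` re-tagged `p`
is INJECTIVE. [claim: Mochizuki2012, status: disputed] -/
theorem thetaPMEllHT_tagF_injective (v₀ : K.V) (H₀ : FK.ThetaPMEllHT) :
    Function.Injective (FKit.ThetaPMEllHT.tagF ι i₀ H₀) := by
  intro p q h
  exact congrArg (fun H : (FK.tagF ι i₀).ThetaPMEllHT => (H.codomain.obj v₀ : ι × FK.FAmb v₀).1) h

/-! ### 3. Def 1.4 and Prop 1.2 (x) at the tagged kit frame, for every kit datum -/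

/-- **IUTchIII:Def1.4** (kurims p.45) The tag type "pairs of integers", placed in the kit's universe. [folklore] -/
abbrev Tag : Type u := ULift.{u} (ℤ × ℤ)

/-- **IUTchIII:Def1.4** (kurims p.45) The base tag `(0, 0)`. [folklore] -/
abbrev tag₀ : Tag.{u} := ULift.up ((0 : ℤ), (0 : ℤ))

variable (L) (hbij : FK.IsomFtoDBijective) (hsurj : FK.IsomFmtoDmSurjective) (hR : FK.RlfOfIsStrip) (X : TimesMuSide FK L)

/-- **IUTchIII:Def1.1** (kurims p.23) The frame assembled from the `ℱ`-tagged kit datum (abc-iut-L6-t3's `StripFrame.ofKits` on the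
transferred data). [claim: Mochizuki2012, status: disputed] -/
abbrev StripFrame.ofKitsTagF : StripFrame.{max 1 u} :=
  StripFrame.ofKits (L.tagF ι i₀) (FKit.isomFtoDBijective_tagF ι i₀ hbij) (FKit.isomFmtoDmSurjective_tagF ι i₀ hsurj)
    (FKit.rlfOfIsStrip_tagF ι i₀ hR) (X.tagF ι i₀)

/-- **IUTchIII:Def1.1(iii)** (kurims p.26) The §1 log-strip interface over the `ℤ × ℤ`-tagged kit frame (abc-iut-L6-t3's `LogStripData.ofKits`
on the transferred `LogKit`). [claim: Mochizuki2012, status: disputed] -/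
abbrev logStripDataTagF (LK : LogKit FK) : LogStripData (StripFrame.ofKitsTagF L Tag.{u} tag₀ hbij hsurj hR X) :=
  LogStripData.ofKits (L.tagF Tag.{u} tag₀) (FKit.isomFtoDBijective_tagF Tag.{u} tag₀ hbij)
    (FKit.isomFmtoDmSurjective_tagF Tag.{u} tag₀ hsurj) (FKit.rlfOfIsStrip_tagF Tag.{u} tag₀ hR) (X.tagF Tag.{u} tag₀)
    (LK.tagF Tag.{u} tag₀)

/-- **IUTchII:Cor4.10(iii)** (kurims p.160) The §1 horizontal-arrow interface over the `ℤ × ℤ`-tagged kit frame (abc-iut-L6-t3's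
`ThetaLinkData.ofKits` on the transferred `ThetaLinkKit`). [claim: Mochizuki2012, status: disputed] -/
abbrev thetaLinkDataTagF (TK : ThetaLinkKit X) : ThetaLinkData (StripFrame.ofKitsTagF L Tag.{u} tag₀ hbij hsurj hR X) :=
  ThetaLinkData.ofKits (L.tagF Tag.{u} tag₀) (FKit.isomFtoDBijective_tagF Tag.{u} tag₀ hbij)
    (FKit.isomFmtoDmSurjective_tagF Tag.{u} tag₀ hsurj) (FKit.rlfOfIsStrip_tagF Tag.{u} tag₀ hR) (X.tagF Tag.{u} tag₀)
    (ThetaLinkKit.tagF (ι := Tag.{u}) (i₀ := tag₀) TK)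

/-- **IUTchIII:Def1.4** (kurims p.45) The family `(n, m) ↦ H₀` re-tagged `(n, m)`. [claim: Mochizuki2012, status: disputed] -/
abbrev theaterFamily (H₀ : FK.ThetaPMEllHT) (p : ℤ × ℤ) : (FK.tagF Tag.{u} tag₀).ThetaPMEllHT :=
  FKit.ThetaPMEllHT.tagF Tag.{u} tag₀ H₀ (ULift.up p)

/-- **IUTchIII:Def1.4** (kurims p.45) "Distinct": the family is injective at any kit with a place. [claim: Mochizuki2012, status: disputed] -/
theorem theaterFamily_injective (v₀ : K.V) (H₀ : FK.ThetaPMEllHT) : Function.Injective (theaterFamily (FK := FK) H₀) :=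
  fun _ _ h => ULift.up_injective (thetaPMEllHT_tagF_injective Tag.{u} tag₀ v₀ H₀ h)

/-- **IUTchIII:Def1.4** (kurims p.45) **[IUTchIII] Def 1.4 INHABITED over the `ℤ × ℤ`-tagged kit, FOR EVERY KIT DATUM**
`(FK, L, hbij, hsurj, hR, X, TK, LK)`, every `Θ^{±ell}`-Hodge theater `H₀` of the kit and every place `v₀`: the log-theta-lattice of the
given kind whose `(n, m)`-theater is `H₀` re-tagged `(n, m)` (abc-iut-L6-t3's `LogThetaLatticeDiagram.ofKits` on the transferred data).
[claim: Mochizuki2012, status: disputed] -/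
def latticeDiagramTagF (TK : ThetaLinkKit X) (LK : LogKit FK) (kind : LatticeKind) (v₀ : K.V) (H₀ : FK.ThetaPMEllHT) :
    LogThetaLatticeDiagram (logStripDataTagF L hbij hsurj hR X LK) (thetaLinkDataTagF L hbij hsurj hR X TK) :=
  LogThetaLatticeDiagram.ofKits (L.tagF Tag.{u} tag₀) (FKit.isomFtoDBijective_tagF Tag.{u} tag₀ hbij)
    (FKit.isomFmtoDmSurjective_tagF Tag.{u} tag₀ hsurj) (FKit.rlfOfIsStrip_tagF Tag.{u} tag₀ hR) (X.tagF Tag.{u} tag₀)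
    (ThetaLinkKit.tagF (ι := Tag.{u}) (i₀ := tag₀) TK) (LK.tagF Tag.{u} tag₀) kind (theaterFamily H₀)
    (theaterFamily_injective v₀ H₀)

/-- **IUTchIII:Def1.4** (kurims p.45) The `(n, m)`-theater of that lattice is `H₀` re-tagged `(n, m)`. [claim: Mochizuki2012, status: disputed] -/
theorem latticeDiagramTagF_HT (TK : ThetaLinkKit X) (LK : LogKit FK) (kind : LatticeKind) (v₀ : K.V) (H₀ : FK.ThetaPMEllHT)
    (p : ℤ × ℤ) :
    (latticeDiagramTagF L hbij hsurj hR X TK LK kind v₀ H₀).HT p = AsSmall.up.obj (HTRep.of (theaterFamily H₀ p)) := rfl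

/-- **IUTchIII:Thm1.5(i)** (kurims p.48) Thm 1.5 (i) (vertical coricity) holds, non-vacuously, for that lattice. [claim: Mochizuki2012, status: disputed] -/
theorem latticeDiagramTagF_vertical_full (TK : ThetaLinkKit X) (LK : LogKit FK) (kind : LatticeKind) (v₀ : K.V)
    (H₀ : FK.ThetaPMEllHT) (n m : ℤ) :
    ((latticeDiagramTagF L hbij hsurj hR X TK LK kind v₀ H₀).vertical n m).inducedDHT = PolyIso.full _ _ := rfl

/-- **IUTchIII:Thm1.5(ii)** (kurims p.48) Thm 1.5 (ii) (horizontal coricity) holds for that lattice (the Cor 4.10 (iv) clause of `TK`,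
transferred). [claim: Mochizuki2012, status: disputed] -/
theorem latticeDiagramTagF_horizontal_full (TK : ThetaLinkKit X) (LK : LogKit FK) (kind : LatticeKind) (v₀ : K.V)
    (H₀ : FK.ThetaPMEllHT) (n m : ℤ) :
    (thetaLinkDataTagF L hbij hsurj hR X TK).linkInducedFxm kind
        ((latticeDiagramTagF L hbij hsurj hR X TK LK kind v₀ H₀).HT (n, m))
        ((latticeDiagramTagF L hbij hsurj hR X TK LK kind v₀ H₀).HT (n + 1, m)) = PolyIso.full _ _ :=
  (latticeDiagramTagF L hbij hsurj hR X TK LK kind v₀ H₀).horizontal_inducedFxm_full n m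

/-- **IUTchIII:Def3.8(iii)** (kurims p.113) abc-iut-L6-t4's Def 3.8 (iii) lattice SKELETON over the tagged kit, for every kit datum (the
bridge `toLGPSkeleton` of the lattice above = `lgpSkeletonOfKits` on the transferred data). [claim: Mochizuki2012, status: disputed] -/
def lgpSkeletonTagF (TK : ThetaLinkKit X) (LK : LogKit FK) (kind : LatticeKind) (v₀ : K.V) (H₀ : FK.ThetaPMEllHT) :
    LGPGaussianLogThetaLattice (HT := (StripFrame.ofKitsTagF L Tag.{u} tag₀ hbij hsurj hR X).HT)
      (fun A B => HTLogLink (logStripDataTagF L hbij hsurj hR X LK) A B) (fun ℓ => ℓ.IsFull) :=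
  (latticeDiagramTagF L hbij hsurj hR X TK LK kind v₀ H₀).toLGPSkeleton

/-- **IUTchIII:Def3.8(iii)** (kurims p.113) The skeleton's `(n, m)`-theater is `H₀` re-tagged `(n, m)`. [claim: Mochizuki2012, status: disputed] -/
theorem lgpSkeletonTagF_theater (TK : ThetaLinkKit X) (LK : LogKit FK) (kind : LatticeKind) (v₀ : K.V) (H₀ : FK.ThetaPMEllHT)
    (n m : ℤ) :
    (lgpSkeletonTagF L hbij hsurj hR X TK LK kind v₀ H₀).theater n m = AsSmall.up.obj (HTRep.of (theaterFamily H₀ (n, m))) := rfl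

/-- **IUTchIII:Def1.4** (kurims p.45) **Non-vacuity of Def 1.4 at `StripFrame.ofKits`, for every kit datum with a theater and a place.**
[claim: Mochizuki2012, status: disputed] -/
theorem nonempty_latticeDiagram_ofKits_tagF (TK : ThetaLinkKit X) (LK : LogKit FK) (kind : LatticeKind) (v₀ : K.V)
    (H₀ : FK.ThetaPMEllHT) :
    Nonempty (LogThetaLatticeDiagram (logStripDataTagF L hbij hsurj hR X LK) (thetaLinkDataTagF L hbij hsurj hR X TK)) :=
  ⟨latticeDiagramTagF L hbij hsurj hR X TK LK kind v₀ H₀⟩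

/-- **IUTchIII:Prop1.2(x)** (kurims p.34) **[IUTchIII] Prop 1.2 (x) INHABITED at the tagged kit frame, FOR EVERY KIT DATUM** with a place,
any infinite tag type (abc-iut-w5-d005's criterion `FrobeniusChain.nonempty_ofKits_iff` fires on `infinite_fStrip_tagF`).
[claim: Mochizuki2012, status: disputed] -/
theorem nonempty_frobeniusChain_ofKits_tagF [Infinite ι] (v₀ : K.V) :
    Nonempty (FrobeniusChain (StripFrame.ofKitsTagF L ι i₀ hbij hsurj hR X)) :=
  (FrobeniusChain.nonempty_ofKits_iff _ _ _ _ _).2 (infinite_fStrip_tagF ι i₀ v₀)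

/-- **IUTchIII:Prop1.2(x)** (kurims p.34) … in particular with the tags "pairs of integers": Def 1.4's lattice and Prop 1.2 (x)'s chain at
the SAME tagged kit frame, for every kit datum. [claim: Mochizuki2012, status: disputed] -/
theorem nonempty_lattice_and_frobeniusChain_ofKits_tagF (TK : ThetaLinkKit X) (LK : LogKit FK) (kind : LatticeKind) (v₀ : K.V)
    (H₀ : FK.ThetaPMEllHT) :
    Nonempty (LogThetaLatticeDiagram (logStripDataTagF L hbij hsurj hR X LK) (thetaLinkDataTagF L hbij hsurj hR X TK)) ∧
      Nonempty (FrobeniusChain (StripFrame.ofKitsTagF L Tag.{u} tag₀ hbij hsurj hR X)) :=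
  ⟨nonempty_latticeDiagram_ofKits_tagF L hbij hsurj hR X TK LK kind v₀ H₀,
    nonempty_frobeniusChain_ofKits_tagF L Tag.{u} tag₀ hbij hsurj hR X v₀⟩

end Generic

end Literature.IUT.LogThetaLattice

end
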